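import Literature.MathematicalPhysics.QuantumFieldTheory.ContinuumLimits
import Literature.MathematicalPhysics.QuantumLattice.LatticeScalarFieldProofs
import Literature.Probability.LatticeModels.ONModelProofs
import Mathlib.MeasureTheory.Measure.Haar.Unique
import HarnessLib

/-!
# Structural lemmas for constructive-qft.S24 (`phi44_triviality`, `phi4_highDim_triviality`)

Sibling proofs file of `Literature/MathematicalPhysics/QuantumFieldTheory/ContinuumLimits.lean`
(theorems only; no statement of that file is changed, no named fact is introduced).

The named facts `phi44_triviality` (Aizenman–Duminil-Copin, Ann. Math. 194 (2021), Thm 1.2,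
"Gaussianity of `Φ⁴₄`") and `phi4_highDim_triviality` (Aizenman 1982, Fröhlich 1982) conclude
`IsGaussianField μ = IsGaussian μ ∧ IsCentered μ` for every scaling limit in law `μ` of the
smeared lattice `φ⁴` field built from the free-boundary box measures `phi4BoxMeasure` — either
in the joint limit `δ → 0⁺`, `δ L(δ) → ∞` of the box laws themselves, or in the printed order
(Aizenman 1982, (13.1): "limits of infinite-volume lattice approximants"; ADC 2021, Def. 1.1:
`lim_{L → ∞} lim_{R/L → ∞}`), i.e. from the thermodynamic limits in law `ν_δ` of the box laws as
the box `R → ∞` at fixed mesh `δ`, followed by `δ → 0⁺`. The printed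
theorems conclude "generalized Gaussian process"; centring is the flip symmetry `φ ↦ -φ` of the
lattice measure ("by flip symmetry `⟨T_{f,L}(σ)^{2n+1}⟩_β = 0`", ADC 2021 §6.3, p. 26). This file
proves that reduction once and for all:

* `isProbabilityMeasure_of_tendstoInLaw`: a limit in law (`TendstoInLaw`, pointwise convergence
  of generating functionals) of probability laws along a non-trivial filter is a probability law
  (`S(0) = μ(univ)`);
* `measurePreserving_neg_phi4Measure`, `…_phi4FreeMeasure`, `…_latticeFieldLaw`: the lattice
  `φ⁴` Gibbs measure (`Measure.tilted` of Lebesgue measure by the even action), its free-boundary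
  extension by zero, and the law of the smeared field are invariant under `φ ↦ -φ`;
* `im_genFunctional_eq_zero_of_measurePreserving_neg`: an even law has a real generating
  functional, and (`im_genFunctional_eq_zero_of_tendstoInLaw`) so has any limit in law of even laws;
* `isCentered_of_isGaussian_of_im_genFunctional_eq_zero`: a Gaussian law on `𝒮'` (Mathlib
  `ProbabilityTheory.IsGaussian`, tested on the evaluation functionals
  `PointwiseConvergenceCLM.evalCLM`) with real generating functional is centred — the
  one-dimensional marginal of `ω(f)` is `N(m, v)` with characteristic function
  `exp(itm - vt²/2)`, real for all `t` only if `m = 0`;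
* `isGaussianField_of_isGaussian_phi4_limit` (joint limit of the box laws) and
  `isGaussianField_of_isGaussian_phi4_thermodynamicLimit` (iterated limit: box `R → ∞` at fixed
  `δ` in law, then `δ → 0⁺`; realness of the generating functional passes through both limits):
  a Gaussian scaling limit of either kind is a centred Gaussian field;
* hence both named facts follow from their variants concluding only
  `ProbabilityTheory.IsGaussian μ`, which is the literal printed conclusion:
  `phi4_highDim_triviality_of_isGaussian` for `phi4_highDim_triviality` as restated in the printed
  regime (thermodynamic limit first; review-split 2026-08-15, landed p36909). (The two-line
  corollaries of the first version of this file, which unfolded the free-boundary joint-limit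
  bodies of the two facts, were withdrawn when both facts went to restatement in the printed
  regime — thermodynamic limit first, and for `d = 4` inside the scaling window `L ≤ M ξ` — after
  the review-split verdicts `misstated` of 2026-08-15; `phi44_triviality_of_isGaussian` returns
  with the restated `phi44_triviality`, `isGaussianField_of_isGaussian_phi4_thermodynamicLimit`
  being the reduction for the restated shape; for the joint-limit shape
  `isGaussianField_of_isGaussian_phi4_limit` gives it in one line.)

What is NOT here: the substance of ADC 2021 (random currents for the Griffiths–Simon class,
the improved tree diagram bound Thm 1.3/7.1, the exponential-moment estimate Prop 1.4/7.2), nor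
of Aizenman 1982 §11–13 / Panis 2023 Thm 5.5 (tree diagram bound and infrared bound for lattice
`φ⁴`, `d ≥ 5`) — the discharges `phi44_triviality_holds`, `phi4_highDim_triviality_holds` remain
open.

## References

* M. Aizenman, H. Duminil-Copin, *Marginal triviality of the scaling limits of critical 4D Ising
  and `φ⁴₄` models*, Ann. Math. 194 (2021) 163–235, arXiv:1912.07973: Def. 1.1, Thm 1.2, §6.3
  [AizenmanDuminilCopinAnnals2021].
* M. Aizenman, *Geometric analysis of `φ⁴` fields and Ising models I, II*, Comm. Math. Phys. 86
  (1982) 1–48: Prop. 10.1 (p. 28), §13 (pp. 39–41: limits of infinite-volume lattice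
  approximants, even theory `S_{2k+1} = 0`) [AizenmanCMP1982].
* J. Glimm, A. Jaffe, *Quantum Physics* (2nd ed. 1987), §6.1–6.2 (generating functionals,
  Gaussian measures on `𝒮'`) [GlimmJaffe1987].

## Mathlib

`ProbabilityTheory.IsGaussian.map_eq_gaussianReal`, `ProbabilityTheory.charFun_gaussianReal`,
`PointwiseConvergenceCLM.evalCLM`, `MeasureTheory.Measure.tilted`,
`MeasureTheory.Measure.IsAddHaarMeasure.isNegInvariant_of_regular` (Lebesgue measure on `V → ℝ` is
even), `MeasureTheory.MeasurePreserving.integral_comp`; from the tree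
`Literature.Probability.LatticeModels.map_tilted_eq_of_invariant` (`ONModelProofs`).
-/

noncomputable section

open scoped SchwartzMap ComplexConjugate NNReal
open MeasureTheory Filter Topology Complex ProbabilityTheory
open Literature.MathematicalPhysics.QuantumLattice
open Literature.Probability.LatticeModels (box glueWith glueWith_apply_mem glueWith_apply_not_mem
  map_tilted_eq_of_invariant)

namespace Literature.MathematicalPhysics.QuantumFieldTheory

/-! ### Generalities on laws of random fields -/

section General

variable {E : Type*} [NormedAddCommGroup E] [NormedSpace ℝ E]

/-- The generating functional at the zero test function is the total mass, `S(0) = μ(𝒮')`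
(as a real number cast to `ℂ`; junk `0` for an infinite measure). (Glimm–Jaffe 1987, §6.1.)
[folklore] -/
theorem genFunctional_zero (μ : Measure (FieldConfig E)) :
    genFunctional μ 0 = (μ.real Set.univ : ℂ) := by
  simp [genFunctional]

/-- **A limit in law of probability laws is a probability law.** If `μ_i → μ` in the sense of
`TendstoInLaw` (pointwise convergence of generating functionals) along a non-trivial filter and
the `μ_i` are eventually probability measures, then `μ(𝒮') = 1`: evaluate at the test function
`0`. (Glimm–Jaffe 1987, §6.1; this is the normalisation remark in the docstring of
`Literature.MathematicalPhysics.QuantumLattice.IsNonGaussian`.) [folklore] -/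
theorem isProbabilityMeasure_of_tendstoInLaw {ι : Type*} {l : Filter ι} [l.NeBot]
    {μs : ι → Measure (FieldConfig E)} {μ : Measure (FieldConfig E)}
    (hμs : ∀ᶠ i in l, IsProbabilityMeasure (μs i)) (h : TendstoInLaw μs l μ) :
    IsProbabilityMeasure μ := by
  have h1 : Tendsto (fun i => genFunctional (μs i) 0) l (𝓝 1) := by
    refine tendsto_const_nhds.congr' ?_
    filter_upwards [hμs] with i hi
    rw [genFunctional_zero]
    simp
  have hlim : genFunctional μ 0 = 1 := tendsto_nhds_unique (h 0) h1
  rw [genFunctional_zero] at hlim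
  have hreal : (μ Set.univ).toReal = 1 := by exact_mod_cast hlim
  exact ⟨(ENNReal.toReal_eq_one_iff _).1 hreal⟩

/-- **An even law has a real generating functional.** If `μ` on `𝒮'` is invariant under
`ω ↦ -ω` then `S(f) = ∫ e^{iω(f)} dμ = ∫ e^{-iω(f)} dμ = conj S(f)`, i.e. `Im S(f) = 0`.
(Glimm–Jaffe 1987, §6.2; ADC 2021, §6.3 "by flip symmetry".) [folklore] -/
theorem im_genFunctional_eq_zero_of_measurePreserving_neg {μ : Measure (FieldConfig E)}
    (hμ : MeasurePreserving (Neg.neg : FieldConfig E → FieldConfig E) μ μ) (f : 𝓢(E, ℝ)) :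
    (genFunctional μ f).im = 0 := by
  rw [← Complex.conj_eq_iff_im]
  have h := hμ.integral_comp measurableEmbedding_neg
    (fun ω : FieldConfig E => cexp (I * ((ω f : ℝ) : ℂ)))
  unfold genFunctional
  rw [← integral_conj, ← h]
  refine integral_congr_ae (Eventually.of_forall fun ω => ?_)
  simp only [IsNegApply.neg_apply, Complex.ofReal_neg, mul_neg, ← Complex.exp_conj, map_mul,
    Complex.conj_I, Complex.conj_ofReal, neg_mul]

/-- **Realness passes to limits in law.** If `μ_i → μ` in law along a non-trivial filter and the
generating functionals `S_{μ_i}(f)` are eventually real, then `S_μ(f)` is real. [folklore] -/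
theorem im_genFunctional_eq_zero_of_tendstoInLaw {ι : Type*} {l : Filter ι} [l.NeBot]
    {μs : ι → Measure (FieldConfig E)} {μ : Measure (FieldConfig E)} (h : TendstoInLaw μs l μ)
    (f : 𝓢(E, ℝ)) (hreal : ∀ᶠ i in l, (genFunctional (μs i) f).im = 0) :
    (genFunctional μ f).im = 0 := by
  have h1 : Tendsto (fun i => (genFunctional (μs i) f).im) l (𝓝 (genFunctional μ f).im) :=
    (Complex.continuous_im.tendsto _).comp (h f)
  have h2 : Tendsto (fun i => (genFunctional (μs i) f).im) l (𝓝 0) :=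
    tendsto_const_nhds.congr' (by filter_upwards [hreal] with i hi; exact hi.symm)
  exact tendsto_nhds_unique h1 h2

/-- The generating functional along the ray `t • f` is the characteristic function of the
one-dimensional marginal of `ω(f)`, i.e. of the push-forward of `μ` under the evaluation
functional `PointwiseConvergenceCLM.evalCLM _ _ f : 𝒮' →L[ℝ] ℝ`. (Glimm–Jaffe 1987, §6.1.)
[folklore] -/
theorem genFunctional_smul_eq_charFun_map (μ : Measure (FieldConfig E)) (f : 𝓢(E, ℝ)) (t : ℝ) :
    genFunctional μ (t • f) =
      charFun (μ.map (PointwiseConvergenceCLM.evalCLM (RingHom.id ℝ) ℝ f)) t := by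
  have h1 : ∀ ω : FieldConfig E,
      (PointwiseConvergenceCLM.evalCLM (RingHom.id ℝ) ℝ f) ω = ω f := fun ω => rfl
  rw [charFun_apply_real, integral_map (by fun_prop) (by fun_prop)]
  unfold genFunctional
  refine integral_congr_ae (Eventually.of_forall fun ω => ?_)
  simp only [h1, map_smul, smul_eq_mul, Complex.ofReal_mul]
  ring_nf

/-- Imaginary part of the Gaussian characteristic function:
`Im exp(itm - vt²/2) = e^{-vt²/2} sin(tm)`. [folklore] -/
theorem im_cexp_gaussian_exponent (t m : ℝ) (v : ℝ≥0) :
    (cexp (t * m * I - v * t ^ 2 / 2)).im =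
      Real.exp (-((v : ℝ) * t ^ 2 / 2)) * Real.sin (t * m) := by
  have hz : (t : ℂ) * m * I - (v : ℂ) * t ^ 2 / 2 =
      ((-((v : ℝ) * t ^ 2 / 2) : ℝ) : ℂ) + ((t * m : ℝ) : ℂ) * I := by
    push_cast
    ring
  rw [hz, Complex.exp_im]
  simp only [Complex.add_re, Complex.add_im, Complex.ofReal_re, Complex.ofReal_im,
    Complex.mul_re, Complex.mul_im, Complex.I_re, Complex.I_im, mul_zero, mul_one, sub_zero,
    zero_add, add_zero]
set_option maxHeartbeats 400000 in
/-- **A Gaussian law on `𝒮'` with real generating functional is centred.** If `μ` is Gaussian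
(Mathlib `ProbabilityTheory.IsGaussian`: every continuous linear functional, in particular every
evaluation `ω ↦ ω(f)`, has a normal law `N(m_f, v_f)`) and `Im S_μ(g) = 0` for all test functions
`g`, then every `ω(f)` is integrable with mean `m_f = 0`: otherwise
`Im S_μ(t f) = e^{-v_f t²/2} sin(t m_f) ≠ 0` at `t = π/(2 m_f)`. (Glimm–Jaffe 1987, §6.2.)
[folklore] -/
theorem isCentered_of_isGaussian_of_im_genFunctional_eq_zero {μ : Measure (FieldConfig E)}
    (hG : IsGaussian μ) (hreal : ∀ g : 𝓢(E, ℝ), (genFunctional μ g).im = 0) : IsCentered μ := by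
  intro f
  set L : FieldConfig E →L[ℝ] ℝ := PointwiseConvergenceCLM.evalCLM (RingHom.id ℝ) ℝ f with hL
  have hLapply : ∀ ω : FieldConfig E, L ω = ω f := fun ω => rfl
  obtain ⟨m, v, hmap⟩ : ∃ (m : ℝ) (v : ℝ≥0), μ.map L = gaussianReal m v :=
    ⟨_, _, hG.map_eq_gaussianReal L⟩
  -- integrability of the evaluation, from the integrability of `id` under the Gaussian marginal
  have hint : Integrable (fun ω : FieldConfig E => ω f) μ := by
    have hid : Integrable (id : ℝ → ℝ) (μ.map L) := by
      rw [hmap]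
      exact memLp_one_iff_integrable.1 (by simpa using memLp_id_gaussianReal (μ := m) (v := v) 1)
    have := (integrable_map_measure (by fun_prop) (by fun_prop)).1 hid
    exact this.congr (Eventually.of_forall hLapply)
  refine ⟨hint, ?_⟩
  -- the mean `∫ ω(f) dμ` is the mean `m` of the marginal
  have hmean : ∫ ω, ω f ∂μ = m := by
    have h := integral_map (μ := μ) (φ := L) (f := fun x : ℝ => x) (by fun_prop) (by fun_prop)
    rw [hmap, integral_id_gaussianReal] at h
    simpa only [hLapply] using h.symm
  rw [hmean]
  by_contra hm0
  set t : ℝ := Real.pi / (2 * m) with ht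
  have htm : t * m = Real.pi / 2 := by
    rw [ht]
    field_simp
  have key : (genFunctional μ (t • f)).im =
      Real.exp (-((v : ℝ) * t ^ 2 / 2)) * Real.sin (t * m) := by
    rw [genFunctional_smul_eq_charFun_map, ← hL, hmap, charFun_gaussianReal,
      im_cexp_gaussian_exponent]
  rw [hreal (t • f), htm, Real.sin_pi_div_two, mul_one] at key
  exact (Real.exp_pos _).ne' key.symm

/-- A Gaussian law on `𝒮'` which is a limit in law of even laws is a centred Gaussian field
(`IsGaussianField`). [folklore] -/
theorem isGaussianField_of_isGaussian_of_tendstoInLaw_of_neg {ι : Type*} {l : Filter ι} [l.NeBot]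
    {μs : ι → Measure (FieldConfig E)} {μ : Measure (FieldConfig E)} (h : TendstoInLaw μs l μ)
    (heven : ∀ᶠ i in l, MeasurePreserving (Neg.neg : FieldConfig E → FieldConfig E) (μs i) (μs i))
    (hG : IsGaussian μ) : IsGaussianField μ :=
  ⟨hG, isCentered_of_isGaussian_of_im_genFunctional_eq_zero hG fun g =>
    im_genFunctional_eq_zero_of_tendstoInLaw h g
      (heven.mono fun _ hi => im_genFunctional_eq_zero_of_measurePreserving_neg hi g)⟩

end General

/-! ### Flip symmetry of the lattice `φ⁴` measures -/

section Flip

variable {V : Type*} [Fintype V] (G : SimpleGraph V) [DecidableRel G.Adj]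

/-- The nearest-neighbour pair interaction is even: `∑ (-φ_x)(-φ_y) = ∑ φ_x φ_y`.
(ADC 2021, (1.12); Glimm–Jaffe 1987, §9.5.) [folklore] -/
theorem pairInteraction_neg (φ : V → ℝ) : pairInteraction G (-φ) = pairInteraction G φ := by
  unfold pairInteraction
  refine Finset.sum_congr rfl fun e _ => ?_
  induction e using Sym2.ind with
  | h x y => simp [Sym2.lift_mk]

/-- The lattice `φ⁴` action is even, `S(-φ) = S(φ)`. (ADC 2021, (1.12); Glimm–Jaffe 1987, §9.5.)
[folklore] -/
theorem phi4Action_neg (g κ J : ℝ) (φ : V → ℝ) :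
    phi4Action G g κ J (-φ) = phi4Action G g κ J φ := by
  have h4 : ∀ a : ℝ, (-a) ^ 4 = a ^ 4 := fun a => by ring
  simp only [phi4Action, Pi.neg_apply, h4, neg_sq, pairInteraction_neg]

/-- **Flip symmetry of the lattice `φ⁴` Gibbs measure**: `φ ↦ -φ` preserves
`phi4Measure G g κ J` (Lebesgue measure on `V → ℝ` is even and so is the action, hence so is the
tilted measure). (ADC 2021, §6.3 "flip symmetry"; Glimm–Jaffe 1987, §9.5.) [folklore] -/
theorem measurePreserving_neg_phi4Measure (g κ J : ℝ) :
    MeasurePreserving (Neg.neg : (V → ℝ) → (V → ℝ))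
      (phi4Measure G g κ J) (phi4Measure G g κ J) := by
  refine ⟨measurable_neg, ?_⟩
  have hvol : (volume : Measure (V → ℝ)).map Neg.neg = volume := Measure.map_neg_eq_self _
  exact map_tilted_eq_of_invariant _ measurable_neg hvol (measurable_phi4Action G g κ J).neg
    fun φ => by simp only [phi4Action_neg]

variable {d : ℕ}

/-- Extension by zero commutes with the flip: `glueZero Λ (-φ) = -glueZero Λ φ`. [folklore] -/
theorem glueZero_neg (Λ : Finset (Literature.Probability.LatticeModels.Site d)) (φ : Λ → ℝ) :
    glueZero Λ (-φ) = -glueZero Λ φ := by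
  funext x
  by_cases hx : x ∈ Λ
  · simp [glueWith_apply_mem _ _ _ hx]
  · simp [glueWith_apply_not_mem _ _ _ hx]

variable (d) in
/-- **Flip symmetry of the free-boundary `φ⁴` measure** on `ℤᵈ → ℝ` (push-forward of the even
graph measure along the odd map `glueZero`). (Glimm–Jaffe 1987, §9.5.) [folklore] -/
theorem measurePreserving_neg_phi4FreeMeasure
    (Λ : Finset (Literature.Probability.LatticeModels.Site d)) (g κ J : ℝ) :
    MeasurePreserving (Neg.neg : (Literature.Probability.LatticeModels.Site d → ℝ) → _)
      (phi4FreeMeasure d Λ g κ J) (phi4FreeMeasure d Λ g κ J) := by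
  have hglue : Measurable (glueZero Λ) := measurable_glueZero Λ
  have hneg : Measurable (Neg.neg : (Literature.Probability.LatticeModels.Site d → ℝ) → _) :=
    measurable_neg
  refine ⟨hneg, ?_⟩
  unfold phi4FreeMeasure
  rw [Measure.map_map hneg hglue]
  have hcomp : (Neg.neg ∘ glueZero Λ :
      (Λ → ℝ) → (Literature.Probability.LatticeModels.Site d → ℝ)) = glueZero Λ ∘ Neg.neg := by
    funext φ
    simp only [Function.comp_apply, glueZero_neg]
  rw [hcomp, ← Measure.map_map hglue measurable_neg,
    (measurePreserving_neg_phi4Measure (zdGraphIn d Λ) g κ J).map_eq]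

/-- The smearing map is odd: `Φ_δ(-φ) = -Φ_δ(φ)`. (ADC 2021, (1.5).) [folklore] -/
theorem finLatticeField_neg (Λ : Finset (Literature.Probability.LatticeModels.Site d)) (δ ρ : ℝ)
    (φ : Literature.Probability.LatticeModels.Site d → ℝ) :
    finLatticeField Λ δ ρ (-φ) = -finLatticeField Λ δ ρ φ := by
  simp only [finLatticeField, Pi.neg_apply, mul_neg, neg_smul, Finset.sum_neg_distrib]

/-- **Flip symmetry of the law of the smeared field**: if `μ` on `ℤᵈ → ℝ` is even then so is
`latticeFieldLaw μ Λ δ ρ` on `𝒮'(ℝᵈ)` (the smearing map is odd and measurable).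
(ADC 2021, §6.3; Glimm–Jaffe 1987, §9.6.) [folklore] -/
theorem measurePreserving_neg_latticeFieldLaw
    {μ : Measure (Literature.Probability.LatticeModels.Site d → ℝ)}
    (hμ : MeasurePreserving (Neg.neg : (Literature.Probability.LatticeModels.Site d → ℝ) → _) μ μ)
    (Λ : Finset (Literature.Probability.LatticeModels.Site d)) (δ ρ : ℝ) :
    MeasurePreserving (Neg.neg : FieldConfig (EuclideanSpace ℝ (Fin d)) → _)
      (latticeFieldLaw μ Λ δ ρ) (latticeFieldLaw μ Λ δ ρ) := by
  have hF : Measurable (finLatticeField (d := d) Λ δ ρ) := measurable_finLatticeField Λ δ ρ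
  have hneg : Measurable (Neg.neg : FieldConfig (EuclideanSpace ℝ (Fin d)) → _) := measurable_neg
  refine ⟨hneg, ?_⟩
  unfold latticeFieldLaw
  rw [Measure.map_map hneg hF]
  have hcomp : (Neg.neg ∘ finLatticeField Λ δ ρ :
      (Literature.Probability.LatticeModels.Site d → ℝ) → FieldConfig (EuclideanSpace ℝ (Fin d))) =
      finLatticeField Λ δ ρ ∘ Neg.neg := by
    funext φ
    simp only [Function.comp_apply, finLatticeField_neg]
  rw [hcomp, ← Measure.map_map hF measurable_neg, hμ.map_eq]

variable (d) in
/-- The laws of the smeared `φ⁴` field under the free-boundary box measures — the approximants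
of constructive-qft.S24 — are even. (ADC 2021, §6.3.) [folklore] -/
theorem measurePreserving_neg_latticeFieldLaw_phi4BoxMeasure (L : ℕ) (g κ J δ ρ : ℝ) :
    MeasurePreserving (Neg.neg : FieldConfig (EuclideanSpace ℝ (Fin d)) → _)
      (latticeFieldLaw (phi4BoxMeasure d L g κ J) (box d L) δ ρ)
      (latticeFieldLaw (phi4BoxMeasure d L g κ J) (box d L) δ ρ) :=
  measurePreserving_neg_latticeFieldLaw (measurePreserving_neg_phi4FreeMeasure d (box d L) g κ J)
    (box d L) δ ρ

end Flip

/-! ### Reduction of S24 to the un-centred Gaussian conclusion -/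

/-- **Centring is automatic in S24.** Every scaling limit in law (along `δ → 0⁺`) of the smeared
lattice `φ⁴` field under the free-boundary box measures which is Gaussian in Mathlib's sense
(`ProbabilityTheory.IsGaussian`) is a centred Gaussian field (`IsGaussianField`): the approximating
laws are even, so the limit has a real generating functional. (ADC 2021, Thm 1.2 with §6.3.)
[cite: AizenmanDuminilCopinAnnals2021, Thm 1.2 and §6.3] -/
theorem isGaussianField_of_isGaussian_phi4_limit {d : ℕ} {g κ : ℝ} {J : ℝ → ℝ} {L : ℝ → ℕ}
    {ρ : ℝ → ℝ} {μ : Measure (FieldConfig (EuclideanSpace ℝ (Fin d)))}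
    (hlim : TendstoInLaw (fun δ : ℝ =>
        latticeFieldLaw (phi4BoxMeasure d (L δ) g κ (J δ)) (box d (L δ)) δ (ρ δ)) (𝓝[>] 0) μ)
    (hG : IsGaussian μ) : IsGaussianField μ :=
  isGaussianField_of_isGaussian_of_tendstoInLaw_of_neg hlim (Eventually.of_forall fun δ =>
    measurePreserving_neg_latticeFieldLaw_phi4BoxMeasure d (L δ) g κ (J δ) δ (ρ δ)) hG

/-- **Realness of the generating functional passes through an iterated limit in law.** If each
`ν_j` (eventually along `l`) is itself a limit in law, along a non-trivial filter, of even laws,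
and `ν_j → μ` in law along `l`, then `S_μ(f)` is real for every test function `f`. [folklore] -/
theorem im_genFunctional_eq_zero_of_tendstoInLaw_of_tendstoInLaw {E : Type*}
    [NormedAddCommGroup E] [NormedSpace ℝ E] {ι ι' : Type*} {l : Filter ι} [l.NeBot]
    {l' : Filter ι'} [l'.NeBot] {νs : ι → Measure (FieldConfig E)}
    {μ : Measure (FieldConfig E)} (h : TendstoInLaw νs l μ)
    (hνs : ∀ᶠ i in l, ∃ μs : ι' → Measure (FieldConfig E), TendstoInLaw μs l' (νs i) ∧
      ∀ᶠ k in l', MeasurePreserving (Neg.neg : FieldConfig E → FieldConfig E) (μs k) (μs k))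
    (f : 𝓢(E, ℝ)) : (genFunctional μ f).im = 0 :=
  im_genFunctional_eq_zero_of_tendstoInLaw h f (hνs.mono fun _ ⟨_, hlim, heven⟩ =>
    im_genFunctional_eq_zero_of_tendstoInLaw hlim f
      (heven.mono fun _ hk => im_genFunctional_eq_zero_of_measurePreserving_neg hk f))

/-- **Centring is automatic in S24, thermodynamic limit first** (the shape of
`phi4_highDim_triviality` in the printed regime: Aizenman 1982, (13.1), "limits of
infinite-volume lattice approximants"; ADC 2021, Def. 1.1, `lim_{L → ∞} lim_{R/L → ∞}`). Let
`ν_δ` be, for every mesh `δ > 0`, a limit in law as the box `R → ∞` of the laws of the smeared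
`φ⁴` field under the free-boundary box measures `phi4BoxMeasure d R g κ (J δ)` (smeared over
`box d R` at mesh `δ` with renormalisation `ρ(δ)`), and let `μ` be the limit in law of `ν_δ` as
`δ → 0⁺`. If `μ` is Gaussian in Mathlib's sense (`ProbabilityTheory.IsGaussian`, the printed
"Gaussian field" / "generalized Gaussian process"), then it is a centred Gaussian field
(`IsGaussianField`): the box laws are even (`measurePreserving_neg_latticeFieldLaw_phi4BoxMeasure`),
so every `ν_δ`, and then `μ`, has a real generating functional
(`im_genFunctional_eq_zero_of_tendstoInLaw_of_tendstoInLaw`), and a Gaussian law on `𝒮'` with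
real generating functional is centred (`isCentered_of_isGaussian_of_im_genFunctional_eq_zero`).
(Aizenman 1982, §12: "in the even theory `S_{2k+1} = 0`"; ADC 2021, §6.3, p. 26.)
[cite: AizenmanCMP1982, §12–13 (pp. 36–41)] -/
theorem isGaussianField_of_isGaussian_phi4_thermodynamicLimit {d : ℕ} {g κ : ℝ} {J : ℝ → ℝ}
    {ρ : ℝ → ℝ} {ν : ℝ → Measure (FieldConfig (EuclideanSpace ℝ (Fin d)))}
    {μ : Measure (FieldConfig (EuclideanSpace ℝ (Fin d)))}
    (hν : ∀ δ, 0 < δ → TendstoInLaw (fun R : ℕ =>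
        latticeFieldLaw (phi4BoxMeasure d R g κ (J δ)) (box d R) δ (ρ δ)) atTop (ν δ))
    (hlim : TendstoInLaw ν (𝓝[>] 0) μ) (hG : IsGaussian μ) : IsGaussianField μ :=
  ⟨hG, isCentered_of_isGaussian_of_im_genFunctional_eq_zero hG fun f =>
    im_genFunctional_eq_zero_of_tendstoInLaw_of_tendstoInLaw hlim
      ((eventually_mem_nhdsWithin (a := (0 : ℝ)) (s := Set.Ioi 0)).mono fun δ hδ =>
        ⟨_, hν δ hδ, Eventually.of_forall fun R =>
          measurePreserving_neg_latticeFieldLaw_phi4BoxMeasure d R g κ (J δ) δ (ρ δ)⟩) f⟩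

/-- **`phi4_highDim_triviality` from its un-centred form** (`d ≥ 5`, printed regime —
thermodynamic limit first; Aizenman 1982, Prop. 10.1 with §12–13; Panis 2023, Thm 5.5 with
Rem. 5.7): the named fact, as restated 2026-08-15, follows from the same statement with
conclusion `ProbabilityTheory.IsGaussian μ` ("describes a Gaussian field" / "every sub-sequential
scaling limit of the model is Gaussian", the printed conclusions), by
`isGaussianField_of_isGaussian_phi4_thermodynamicLimit`. [cite: AizenmanCMP1982, Prop. 10.1 (p. 28) and §12–13 (pp. 36–41)] -/
theorem phi4_highDim_triviality_of_isGaussian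
    (h : ∀ (d : ℕ), 5 ≤ d → ∀ (g κ : ℝ), 0 < g → ∀ (J : ℝ → ℝ) (ρ : ℝ → ℝ)
      (ν : ℝ → Measure (FieldConfig (EuclideanSpace ℝ (Fin d))))
      (μ : Measure (FieldConfig (EuclideanSpace ℝ (Fin d)))),
      (∀ δ, 0 < δ → 0 ≤ J δ ∧ J δ ≤ phi4CriticalJ d g κ) →
      (∃ J₀ : ℝ, 0 < J₀ ∧ ∀ᶠ δ in 𝓝[>] (0 : ℝ), J₀ ≤ J δ) →
      (∀ δ, 0 < δ → TendstoInLaw (fun R : ℕ =>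
          latticeFieldLaw (phi4BoxMeasure d R g κ (J δ)) (box d R) δ (ρ δ)) atTop (ν δ)) →
      TendstoInLaw ν (𝓝[>] 0) μ →
      HasBoundedNondegenerateTwoPoint μ → IsGaussian μ) :
    phi4_highDim_triviality := fun d hd g κ hg J ρ ν μ hJ hJ₀ hν hlim h2 =>
  isGaussianField_of_isGaussian_phi4_thermodynamicLimit hν hlim
    (h d hd g κ hg J ρ ν μ hJ hJ₀ hν hlim h2)

/-- The free-boundary box `φ⁴` measure is a probability measure for `g > 0` (push-forward of
the graph measure, a probability measure by the discharged fact
`isProbabilityMeasure_phi4Measure_holds`). (Glimm–Jaffe 1987, §9.5–9.6.) [folklore] -/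
theorem isProbabilityMeasure_phi4BoxMeasure (d L : ℕ) {g : ℝ} (hg : 0 < g) (κ J : ℝ) :
    IsProbabilityMeasure (phi4BoxMeasure d L g κ J) := by
  haveI : IsProbabilityMeasure (phi4Measure (zdGraphIn d (box d L)) g κ J) :=
    isProbabilityMeasure_phi4Measure_holds _ hg κ J
  exact Measure.isProbabilityMeasure_map (measurable_glueZero (box d L)).aemeasurable

/-- Every S24 scaling limit `μ` (limit in law as `δ → 0⁺` of the smeared `φ⁴` field under the
free-boundary box measures, `g > 0`) is a probability measure. [folklore] -/
theorem isProbabilityMeasure_phi4_limit {d : ℕ} {g κ : ℝ} (hg : 0 < g) {J : ℝ → ℝ} {L : ℝ → ℕ}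
    {ρ : ℝ → ℝ} {μ : Measure (FieldConfig (EuclideanSpace ℝ (Fin d)))}
    (hlim : TendstoInLaw (fun δ : ℝ =>
        latticeFieldLaw (phi4BoxMeasure d (L δ) g κ (J δ)) (box d (L δ)) δ (ρ δ)) (𝓝[>] 0) μ) :
    IsProbabilityMeasure μ := by
  refine isProbabilityMeasure_of_tendstoInLaw (Eventually.of_forall fun δ => ?_) hlim
  haveI := isProbabilityMeasure_phi4BoxMeasure d (L δ) hg κ (J δ)
  infer_instance

end Literature.MathematicalPhysics.QuantumFieldTheory

end

/-! ## Appendix (literature-prover, 2026-08-15): the Ising case of constructive-qft.S24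

Structural lemmas for the Ising renderings of constructive-qft.S24 / crit-ising.S13
(Aizenman–Duminil-Copin, Ann. Math. 194 (2021), Thm 1.2 with §1.3 and Prop. 1.4). As for
`phi44_triviality` above, centring of a Gaussian scaling limit is automatic whenever the
approximating laws of the smeared spin field `Φ_δ(f) = ρ δᵈ ∑_{x ∈ Λ} f(δx) σₓ` are even
("by flip symmetry `⟨T_{f,L}(σ)^{2n+1}⟩_β = 0`", ADC §6.3, p. 26), so that the centred conclusion
`IsGaussianField μ` reduces to Mathlib's `ProbabilityTheory.IsGaussian μ` ("is a generalized
Gaussian process", the printed conclusion of ADC Thm 1.2). Two kinds of approximants are covered.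

* *Free-boundary finite volumes* — the laws under `isingMeasure (zdGraph d) Λ β 0 .free` at zero
  external field (the approximants of the free-boundary renderings of S24, among them the
  rendering of `ising4_triviality` in force until 2026-08-15): `isGaussianField_of_isGaussian_ising_limit`.
  A point specific to the tree's `isingMeasure … .free` (`Literature.Probability.LatticeModels`,
  Friedli–Velenik form): the measure lives on the *infinite* configuration space `V → ℤˣ` and
  freezes the spins off `Λ` to the junk value `1` (`BoundaryCondition.outside`), so the *global*
  flip `σ ↦ -σ` does **not** preserve it. What holds is the law-level form of the tree's
  `isingCorr_flip`: for every measurable observable, the law under `μ_{Λ;β,-h}^{bc.flip}` of the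
  observable precomposed with the *inside* flip `glue Λ τ bc ↦ glue Λ (-τ) bc.flip` is its law
  under `μ_{Λ;β,h}^{bc}` (`map_isingMeasure_flip_eq`, a change of variables `τ ↦ -τ` in the finite
  Boltzmann sum `isingMeasure_apply_of_measurableSet`). The smeared spin field over `Λ` only reads
  spins in `Λ` and is odd under the inside flip (`spinField_glue_neg_flip`), whence the law of
  `-Φ_δ` under `(bc.flip, -h)` is the law of `Φ_δ` under `(bc, h)`
  (`map_neg_spinFieldLaw_isingMeasure`) and, for `bc = free`, `h = 0`, the law of `Φ_δ` is even
  (`measurePreserving_neg_spinFieldLaw_isingMeasure_free`).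
* *Flip-invariant states on `ℤᵈ`* — the approximants of `ising4_triviality` as restated on
  2026-08-15 in the printed regime (infinite-volume DLR states `ν ∈ 𝒢(β, 0)`, `β ≤ β_c`, smeared
  over boxes `{−L(δ), …, L(δ)}⁴`): the smeared spin field is odd under the *global* flip
  `σ ↦ -σ` (`spinField_neg`), so its law under any flip-invariant state is even
  (`measurePreserving_neg_spinFieldLaw_of_neg`) and every Gaussian limit in law of such laws is a
  centred Gaussian field (`isGaussianField_of_isGaussian_spinFieldLaw_limit_of_even`). Flip
  invariance of the zero-field DLR states at `β ≤ β_c` — the flip maps `𝒢(β, 0)` onto itself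
  (`Literature.Probability.LatticeModels.isGibbsMeasure_map_neg`, `IsingGibbsFlip`) and `𝒢(β, 0)`
  is a singleton there (Aizenman–Barsky–Fernández 1987 below `β_c`; Aizenman–Duminil-Copin–
  Sidoravicius 2015 at `β_c`) — is an input left to the consumer.

What is NOT here: the substance of ADC 2021 for the Ising model (random currents, the improved
tree diagram bound Thm 1.3, the exponential-moment estimate Prop. 1.4 — vendored in the
infinite-volume printed regime as
`Literature.Probability.LatticeModels.aizenmanDuminilCopin_mgf_normalizedField_bound`) — the
discharge `ising4_triviality_holds` remains open. The two-line corollary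
`ising4_triviality_of_isGaussian` of the first version of this appendix, specialised to the
quantifier shape of the free-boundary rendering of `ising4_triviality`, was withdrawn together
with that rendering (defact verdict `misstated`, 2026-08-15: free-boundary boxes in the joint
limit `δ L(δ) → ∞` and temperatures outside the window `L ≤ ξ(β)` are not covered by the printed
theorem); the general reductions of this appendix replace it.

References: Aizenman–Duminil-Copin 2021, Thm 1.2, §1.3, §6.3 [AizenmanDuminilCopinAnnals2021];
Friedli–Velenik, *Statistical Mechanics of Lattice Systems* (2017), §3.7.1 (spin-flip symmetry)
[FriedliVelenik2017].
-/

noncomputable section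

open scoped SchwartzMap
open MeasureTheory Filter Topology ProbabilityTheory
open Literature.MathematicalPhysics.QuantumLattice
open Literature.Probability.LatticeModels (box zdGraph glue BoundaryCondition SpinConfig spinAt
  spinAt_neg isingMeasure isingWeight isingPartitionFunction criticalBeta isingWeight_neg_flip
  isingPartitionFunction_flip isingMeasure_apply_of_measurableSet spinAt_glue_neg_flip_of_mem)

namespace Literature.MathematicalPhysics.QuantumFieldTheory

/-! ### Spin-flip symmetry of the finite-volume Ising measures, at the level of laws -/

section IsingFlip

variable {V : Type*} (G : SimpleGraph V) [DecidableEq V] [G.LocallyFinite]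

/-- **Spin-flip symmetry of the finite-volume Ising Gibbs measure, law-level form.** For a
finite volume `Λ`, any boundary condition `bc` and field `h`, and measurable observables `F`,
`F'` related by the inside flip, `F' (glue Λ τ bc.flip) = F (glue Λ (-τ) bc)` for all finite
configurations `τ`, the law of `F'` under `μ_{Λ;β,-h}^{bc.flip}` equals the law of `F` under
`μ_{Λ;β,h}^{bc}`: both measures are Boltzmann-weighted counts of glued configurations
(`isingMeasure_apply_of_measurableSet`), the weights agree after `τ ↦ -τ`
(`isingWeight_neg_flip`) and so do the partition functions (`isingPartitionFunction_flip`).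
This is the measure-theoretic form of the tree's `isingCorr_flip`
(Friedli–Velenik 2017, §3.7.1 and Exercise 3.4). [cite: FriedliVelenik2017, §3.7.1] -/
theorem map_isingMeasure_flip_eq {X : Type*} [MeasurableSpace X] (Λ : Finset V) (β h : ℝ)
    (bc : BoundaryCondition V) {F F' : SpinConfig V → X} (hF : Measurable F)
    (hF' : Measurable F') (hFF' : ∀ τ : Λ → ℤˣ, F' (glue Λ τ bc.flip) = F (glue Λ (-τ) bc)) :
    (isingMeasure G Λ β (-h) bc.flip).map F' = (isingMeasure G Λ β h bc).map F := by
  classical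
  ext S hS
  rw [Measure.map_apply hF' hS, Measure.map_apply hF hS,
    isingMeasure_apply_of_measurableSet G Λ β (-h) bc.flip (hF' hS),
    isingMeasure_apply_of_measurableSet G Λ β h bc (hF hS), isingPartitionFunction_flip]
  suffices hsum : (∑ τ : Λ → ℤˣ with glue Λ τ bc.flip ∈ F' ⁻¹' S,
      isingWeight G Λ β (-h) bc.flip τ) =
      ∑ τ : Λ → ℤˣ with glue Λ τ bc ∈ F ⁻¹' S, isingWeight G Λ β h bc τ by
    rw [hsum]
  have key : ∀ τ : Λ → ℤˣ, (glue Λ τ bc.flip ∈ F' ⁻¹' S ↔ glue Λ (-τ) bc ∈ F ⁻¹' S) := fun τ => by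
    simp only [Set.mem_preimage, hFF']
  rw [Finset.sum_filter, Finset.sum_filter]
  refine Fintype.sum_equiv (Equiv.neg _) _ _ fun τ => ?_
  rw [Equiv.neg_apply, ← isingWeight_neg_flip G Λ β h bc (-τ), neg_neg]
  exact if_congr (key τ) rfl rfl

end IsingFlip

/-! ### The smeared spin field is odd under the inside flip -/

section SpinField

variable {d : ℕ}

/-- The smeared spin field over `Λ` reads only spins in `Λ`, where gluing the flipped finite
configuration (with the flipped boundary condition) is the flip; hence
`Φ_δ(glue Λ (-τ) bc.flip) = -Φ_δ(glue Λ τ bc)`. (ADC 2021, (1.5); Friedli–Velenik 2017,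
§3.7.1.) [folklore] -/
theorem spinField_glue_neg_flip (Λ : Finset (Literature.Probability.LatticeModels.Site d))
    (δ ρ : ℝ) (τ : Λ → ℤˣ)
    (bc : BoundaryCondition (Literature.Probability.LatticeModels.Site d)) :
    spinField Λ δ ρ (glue Λ (-τ) bc.flip) = -spinField Λ δ ρ (glue Λ τ bc) := by
  unfold spinField finLatticeField
  rw [← Finset.sum_neg_distrib]
  refine Finset.sum_congr rfl fun x hx => ?_
  dsimp only
  rw [spinAt_glue_neg_flip_of_mem Λ τ bc hx, mul_neg, neg_smul]

/-- **The law of `-Φ_δ` under `μ_{Λ;β,-h}^{bc.flip}` is the law of `Φ_δ` under `μ_{Λ;β,h}^{bc}`**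
(smeared spin field over the volume `Λ` itself, nearest-neighbour Ising model on `ℤᵈ`).
(Friedli–Velenik 2017, §3.7.1; ADC 2021, §6.3 "flip symmetry".) [folklore] -/
theorem map_neg_spinFieldLaw_isingMeasure
    (Λ : Finset (Literature.Probability.LatticeModels.Site d)) (β h δ ρ : ℝ)
    (bc : BoundaryCondition (Literature.Probability.LatticeModels.Site d)) :
    (spinFieldLaw (isingMeasure (zdGraph d) Λ β (-h) bc.flip) Λ δ ρ).map Neg.neg =
      spinFieldLaw (isingMeasure (zdGraph d) Λ β h bc) Λ δ ρ := by
  unfold spinFieldLaw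
  rw [Measure.map_map measurable_neg (measurable_spinField Λ δ ρ)]
  refine map_isingMeasure_flip_eq (zdGraph d) Λ β h bc (measurable_spinField Λ δ ρ)
    (measurable_neg.comp (measurable_spinField Λ δ ρ)) fun τ => ?_
  have h1 := spinField_glue_neg_flip Λ δ ρ τ bc.flip
  rw [BoundaryCondition.flip_flip] at h1
  rw [Function.comp_apply, h1]

/-- **Flip symmetry of the free-boundary approximants of S24 (Ising)**: under the free-boundary
finite-volume Ising measure at zero external field, the law of the smeared spin field over the
volume is even (`free.flip = free`, `-0 = 0`). (ADC 2021, §6.3, p. 26, "by flip symmetry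
`⟨T_{f,L}(σ)^{2n+1}⟩_β = 0`"; Friedli–Velenik 2017, §3.7.1, eq. (3.33).)
[cite: AizenmanDuminilCopinAnnals2021, §6.3] -/
theorem measurePreserving_neg_spinFieldLaw_isingMeasure_free
    (Λ : Finset (Literature.Probability.LatticeModels.Site d)) (β δ ρ : ℝ) :
    MeasurePreserving (Neg.neg : FieldConfig (EuclideanSpace ℝ (Fin d)) → _)
      (spinFieldLaw (isingMeasure (zdGraph d) Λ β 0 .free) Λ δ ρ)
      (spinFieldLaw (isingMeasure (zdGraph d) Λ β 0 .free) Λ δ ρ) := by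
  refine ⟨measurable_neg, ?_⟩
  have h := map_neg_spinFieldLaw_isingMeasure Λ β 0 δ ρ
    (.free : BoundaryCondition (Literature.Probability.LatticeModels.Site d))
  rwa [neg_zero, BoundaryCondition.flip_free] at h

end SpinField

/-! ### The smeared spin field is odd under the global flip: flip-invariant states on `ℤᵈ` -/

section GlobalFlip

variable {d : ℕ}

/-- The smeared spin field is odd under the *global* flip `σ ↦ -σ` of `SpinConfig ℤᵈ`:
`Φ_δ(-σ) = -Φ_δ(σ)`, since every spin changes sign (`spinAt_neg`) and the smearing map is
linear (`finLatticeField_neg`). (ADC 2021, (1.5) and §6.3; Friedli–Velenik 2017, §3.7.1.)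
[folklore] -/
theorem spinField_neg (Λ : Finset (Literature.Probability.LatticeModels.Site d)) (δ ρ : ℝ)
    (σ : SpinConfig (Literature.Probability.LatticeModels.Site d)) :
    spinField Λ δ ρ (-σ) = -spinField Λ δ ρ σ := by
  have h : (fun x : Literature.Probability.LatticeModels.Site d => spinAt x (-σ)) =
      -fun x : Literature.Probability.LatticeModels.Site d => spinAt x σ :=
    funext fun x => spinAt_neg x σ
  unfold spinField
  rw [h, finLatticeField_neg]

/-- **Flip-invariant states have even smeared-field laws.** If a law `ν` on `SpinConfig ℤᵈ` is
invariant under the global flip `σ ↦ -σ` (e.g. the zero-field infinite-volume Ising state at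
`β ≤ β_c`, by uniqueness), then the law `spinFieldLaw ν Λ δ ρ` of the smeared spin field on
`𝒮'(ℝᵈ)` is invariant under `ω ↦ -ω`: the smearing map is odd (`spinField_neg`) and measurable.
(ADC 2021, §6.3, p. 26, "by flip symmetry `⟨T_{f,L}(σ)^{2n+1}⟩_β = 0`" for the infinite-volume
state `⟨·⟩_β`; Friedli–Velenik 2017, §3.7.1.) [cite: AizenmanDuminilCopinAnnals2021, §6.3 (p. 26)] -/
theorem measurePreserving_neg_spinFieldLaw_of_neg
    {ν : Measure (SpinConfig (Literature.Probability.LatticeModels.Site d))}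
    (hν : MeasurePreserving
      (Neg.neg : SpinConfig (Literature.Probability.LatticeModels.Site d) → _) ν ν)
    (Λ : Finset (Literature.Probability.LatticeModels.Site d)) (δ ρ : ℝ) :
    MeasurePreserving (Neg.neg : FieldConfig (EuclideanSpace ℝ (Fin d)) → _)
      (spinFieldLaw ν Λ δ ρ) (spinFieldLaw ν Λ δ ρ) := by
  have hF : Measurable (spinField (d := d) Λ δ ρ) := measurable_spinField Λ δ ρ
  have hneg : Measurable (Neg.neg : FieldConfig (EuclideanSpace ℝ (Fin d)) → _) := measurable_neg
  refine ⟨hneg, ?_⟩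
  unfold spinFieldLaw
  rw [Measure.map_map hneg hF]
  have hcomp : (Neg.neg ∘ spinField Λ δ ρ :
      SpinConfig (Literature.Probability.LatticeModels.Site d) →
        FieldConfig (EuclideanSpace ℝ (Fin d))) = spinField Λ δ ρ ∘ Neg.neg := by
    funext σ
    simp only [Function.comp_apply, spinField_neg]
  rw [hcomp, ← Measure.map_map hF measurable_neg, hν.map_eq]

end GlobalFlip

/-! ### Reduction of the Ising renderings of S24 to the un-centred Gaussian conclusion -/

/-- Every scaling limit in law, along `δ → 0⁺`, of the smeared Ising spin field under
finite-volume Gibbs measures (any inverse temperatures, fields, boundary conditions, volumes and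
renormalisations) is a probability measure. [folklore] -/
theorem isProbabilityMeasure_ising_limit {d : ℕ} {β ρ : ℝ → ℝ} {h : ℝ → ℝ}
    {Λ : ℝ → Finset (Literature.Probability.LatticeModels.Site d)}
    {bc : ℝ → BoundaryCondition (Literature.Probability.LatticeModels.Site d)}
    {μ : Measure (FieldConfig (EuclideanSpace ℝ (Fin d)))}
    (hlim : TendstoInLaw (fun δ : ℝ =>
        spinFieldLaw (isingMeasure (zdGraph d) (Λ δ) (β δ) (h δ) (bc δ)) (Λ δ) δ (ρ δ))
      (𝓝[>] 0) μ) :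
    IsProbabilityMeasure μ :=
  isProbabilityMeasure_of_tendstoInLaw (Eventually.of_forall fun _ => inferInstance) hlim

/-- **Centring is automatic for free-boundary approximants.** Every scaling limit in law (along
`δ → 0⁺`) of the smeared spin field under the free-boundary, zero-field finite-volume Ising
measures which is Gaussian in Mathlib's sense (`ProbabilityTheory.IsGaussian`) is a centred
Gaussian field (`IsGaussianField`): the approximating laws are even
(`measurePreserving_neg_spinFieldLaw_isingMeasure_free`), so the limit has a real generating
functional, and a Gaussian law on `𝒮'` with real generating functional is centred
(`isCentered_of_isGaussian_of_im_genFunctional_eq_zero`). Stated for any dimension, volumes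
`box d (L δ)`, temperatures `β(δ)` and renormalisations `ρ(δ)`.
(ADC 2021, Thm 1.2 with §1.3 and §6.3.) [cite: AizenmanDuminilCopinAnnals2021, Thm 1.2 and §6.3] -/
theorem isGaussianField_of_isGaussian_ising_limit {d : ℕ} {β : ℝ → ℝ} {L : ℝ → ℕ} {ρ : ℝ → ℝ}
    {μ : Measure (FieldConfig (EuclideanSpace ℝ (Fin d)))}
    (hlim : TendstoInLaw (fun δ : ℝ =>
        spinFieldLaw (isingMeasure (zdGraph d) (box d (L δ)) (β δ) 0 .free) (box d (L δ)) δ (ρ δ))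
      (𝓝[>] 0) μ)
    (hG : IsGaussian μ) : IsGaussianField μ :=
  isGaussianField_of_isGaussian_of_tendstoInLaw_of_neg hlim (Eventually.of_forall fun δ =>
    measurePreserving_neg_spinFieldLaw_isingMeasure_free (box d (L δ)) (β δ) δ (ρ δ)) hG

/-- **Centring is automatic for flip-invariant states** (the shape of `ising4_triviality` as
restated 2026-08-15). Let `ν_δ` be laws on `SpinConfig ℤᵈ` which are eventually (as `δ → 0⁺`)
invariant under the global flip `σ ↦ -σ`, smeared over volumes `Λ(δ)` with renormalisations
`ρ(δ)`; let `μ` be a law on `𝒮'(ℝᵈ)` which is the limit in law of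
`spinFieldLaw (ν δ) (Λ δ) δ (ρ δ)`. If `μ` is Gaussian in Mathlib's sense
(`ProbabilityTheory.IsGaussian`, "a generalized Gaussian process" — the printed conclusion of ADC
Thm 1.2), then it is a centred Gaussian field (`IsGaussianField`): the approximating laws are
eventually even (`measurePreserving_neg_spinFieldLaw_of_neg`), so the limit has a real generating
functional (`im_genFunctional_eq_zero_of_tendstoInLaw`) and is centred
(`isCentered_of_isGaussian_of_im_genFunctional_eq_zero`). For the zero-field DLR states at
`β ≤ β_c` flip invariance follows from uniqueness (`IsingGibbsFlip`, module docstring).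
(ADC 2021, Thm 1.2 with §1.3; §6.3, p. 26, "by flip symmetry `⟨T_{f,L}(σ)^{2n+1}⟩_β = 0`".)
[cite: AizenmanDuminilCopinAnnals2021, Thm 1.2 and §6.3 (p. 26)] -/
theorem isGaussianField_of_isGaussian_spinFieldLaw_limit_of_even {d : ℕ}
    {ν : ℝ → Measure (SpinConfig (Literature.Probability.LatticeModels.Site d))}
    {Λ : ℝ → Finset (Literature.Probability.LatticeModels.Site d)} {ρ : ℝ → ℝ}
    {μ : Measure (FieldConfig (EuclideanSpace ℝ (Fin d)))}
    (heven : ∀ᶠ δ in 𝓝[>] (0 : ℝ), MeasurePreserving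
      (Neg.neg : SpinConfig (Literature.Probability.LatticeModels.Site d) → _) (ν δ) (ν δ))
    (hlim : TendstoInLaw (fun δ : ℝ => spinFieldLaw (ν δ) (Λ δ) δ (ρ δ)) (𝓝[>] 0) μ)
    (hG : IsGaussian μ) : IsGaussianField μ :=
  isGaussianField_of_isGaussian_of_tendstoInLaw_of_neg hlim
    (heven.mono fun δ hδ => measurePreserving_neg_spinFieldLaw_of_neg hδ (Λ δ) δ (ρ δ)) hG

end Literature.MathematicalPhysics.QuantumFieldTheory

end
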